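import Literature.IUT.HodgeArakelov.BadPrimeGaussianMonoidsGenuineRecordInftyProofs

/-!
# [IUTchII] Cor 3.5 (ii) ∞-level "⥲ ∞Ψ" up to torsion + Rmk 3.6.1 iso-equivariance at the genuine `θ_env` data of `X̲̲_K` for
# ANY family of inversion actions (print's OUTER `ι_Ÿ`, Rmk 1.4.1 (ii)) — proof-only re-statement of `…GenuineRecordInftyProofs`

S. Mochizuki, *Inter-universal Teichmüller theory II*, kurims Dec-2020 manuscript, Cor 3.5 (ii) p. 95 (bracket: the `N`-th roots
are determined up to the `N`-torsion of `Ψ^×_cns`), Rmk 3.6.1 p. 101, Prop 2.2 (i) p. 66, Rmk 1.4.1 (ii) p. 28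
[cite: Mochizuki2012, Cor 3.5 (ii) p.95]. Claim key DISPUTED (D-0012). PROOF-ONLY companion (abc-iut cell, layer L6, seat
abc-iut-w4-d004 gen 3; node **IUTchII:Cor3.5(ii)** ∞-level + IUTchII:Rmk3.6.1; sub-DAG rows Cor-35.ii.r10/r12). NO definition,
NO `Prop` fact, NO instance.

WHY THIS FILE. abc-iut-w4-d004 gen 2's `…thetaEnvRecordKummer_of_mem_thetaEnv` theorems (p425905) are stated for abc-iut-w4-d019's
v1 record (inner `ι₀` — degenerate per the v2 note of `ThetaEnvDataRecordModel.lean`); their proofs depend on the record only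
through the bridge `ThetaEnvData.toRecord`. HERE they are re-stated for `(EtaleLevels.thetaEnvData …).toRecord (h1LimConjMulAut …)
(h1LimKummerOn c hA hfi O) iota` with an ARBITRARY inversion family `iota` (abc-iut-w4-d030's shape), completing — with this
seat's `…GenuineRecordGaloisFamily` / `…GenuineRecordRestrictionIsoFamily` — the print-faithful (outer-`ι`) coverage of every
Cor 3.5 (ii) clause at the genuine data:
* `restrictionIso'_equivariant_toRecord_of_mem_thetaEnv` (Rmk 3.6.1: any restriction iso out of `M^×_TM · θ^ℕ` intertwines the
  `G_v`-action through `s_{t₀}` with the diagonal action),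
* `pi_restriction_inftyThetaMonoid_upToTorsion_toRecord_of_mem_thetaEnv` (the ∞-level clause up to `Ψ^μ`-torsion; input `hroots`).
Inputs = evaluation-sections DATA + model data (+ `hroots` for the ∞-level). Nothing here asserts a disputed claim or takes a side
on [IUTchIII] Cor 3.12; typed ≠ proved ≠ endorsed.
-/

noncomputable section

namespace Literature.IUT.HodgeArakelov

namespace EtaleLevels

open Literature.AnabelianGeometry.EtaleTheta CohomologySystemOfContH1 EtaleThetaDataOfSetting TemperedThetaMonoids
  BadPrimeGaussianMonoids

variable {p : ℕ} [Fact p.Prime] {D : Literature.AnabelianGeometry.EtaleTheta.ThetaSetting p}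
  {E : D.EtaleThetaData} {l : ℕ} (C : E.DoubleUnderline l) (hC : D.Compat) (hS : D.Sec2Hyps)
  (hl : l.Prime) (hp2 : p ≠ 2) (hpl : p ≠ l) (hζ : ∃ ζ : D.K, IsPrimitiveRoot ζ (4 * l))
  (mods : ∀ M : ℕ+, D.CyclotomeMod l M)
  (f : contCocycles D.toTheta D.DeltaTheta C.GtpYdduu) (hf : f ∈ C.rootCocycles hC)
  (hmods : ∀ (M M' : ℕ+) (h : (M : ℕ) ∣ (M' : ℕ)) (x : D.lDeltaTheta l),
    MuN.red p M M' h ((mods M').red x) = (mods M).red x)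
  (h15 : Literature.AnabelianGeometry.EtaleTheta.ThetaSetting.Prop15iii E hC) (L : C.CuspLabels)
  (hZ : ∀ M : ℕ+, Nonempty (ModelCyclotomes.lDeltaQuot (C.rigidData (mods M) hC hS h15 L) ≃*
    Literature.IUT.HodgeTheaters.ZHat))
  (hcharY : EtaleThetaDataOfSetting.PiYddCharacteristic C)
  (hlim : Function.Bijective (rigidLimHom C hC hS hl hp2 hpl hζ mods f hf hmods h15 L hZ))
  [(EtaleThetaDataOfSetting.PiYdd C).Normal]
  {A : Type} [CommGroup A] [MulDistribMulAction (Pi C) A] [TopologicalSpace A] [RootableBy A ℕ]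
  (c : CyclotomeCoefficients (phi C) (D.lDeltaTheta l) A)
  (hA : ∀ b : A, IsOpen (MulAction.stabilizer (Pi C) b : Set (Pi C)))
  (hfi : ∀ b : A, (MulAction.stabilizer (Pi C) b).FiniteIndex)
  (O : Submonoid A) (hO : ∀ (σ : Pi C) (b : A), b ∈ O → σ • b ∈ O)
  {Iota : Type}
  (iota : Iota → ((thetaEnvData C hC hS hl hp2 hpl hζ mods f hf hmods h15 L hZ hcharY hlim).D.coh.lim ≃+
    (thetaEnvData C hC hS hl hp2 hpl hζ mods f hf hmods h15 L hZ hcharY hlim).D.coh.lim))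
  {Lbl : Type*} {P₀ : TopGroup.{0}} (φ₀ : P₀ →* D.GtpTheta) (s : Lbl → (P₀ →* Pi C))
  (hι : ∀ t, Continuous ((MonoidHom.id (Pi C)).comp (s t)))
  (hN : ∀ t, (⊤ : Subgroup P₀).map ((MonoidHom.id (Pi C)).comp (s t)) ≤ PiYdd C)
  (hφ : ∀ t, (phi C).comp ((MonoidHom.id (Pi C)).comp (s t)) = φ₀)

include hO in
/-- **IUTchII:Rmk3.6.1** (kurims p.101) **AT THE GENUINE `θ_env` DATA, ANY inversion family `iota`**: for every `θ ∈ θ^ι_env(𝕄_*)`, any restriction isomorphism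
`e` out of `M^×_TM · θ^ℕ` (product restriction on elements) intertwines the action of `G_v` through the section `s_{t₀}` with
the DIAGONAL action; inputs = evaluation-sections data + model data. [cite: Mochizuki2012, Rmk 3.6.1 p.101] -/
theorem restrictionIso'_equivariant_toRecord_of_mem_thetaEnv
    {K : Type*} [Group K] (q : Pi C →* K) (hq : ∀ x : Pi C, q x = 1 → ∀ a ∈ O, x • a = a) (w : P₀ →* K)
    (hsec : ∀ t g, q (s t g) = w g) {i₀ : Iota}
    {θ : ((thetaEnvData C hC hS hl hp2 hpl hζ mods f hf hmods h15 L hZ hcharY hlim).toRecord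
        (h1LimConjMulAut (phi C) (D.lDeltaTheta l) (PiYdd C)) (h1LimKummerOn (phi C) (D.lDeltaTheta l) (PiYdd C) c hA hfi O)
        iota).H}
    (hθ : θ ∈ ((thetaEnvData C hC hS hl hp2 hpl hζ mods f hf hmods h15 L hZ hcharY hlim).toRecord
        (h1LimConjMulAut (phi C) (D.lDeltaTheta l) (PiYdd C)) (h1LimKummerOn (phi C) (D.lDeltaTheta l) (PiYdd C) c hA hfi O)
        iota).thetaEnv i₀)
    (R : Lbl → (((thetaEnvData C hC hS hl hp2 hpl hζ mods f hf hmods h15 L hZ hcharY hlim).toRecord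
        (h1LimConjMulAut (phi C) (D.lDeltaTheta l) (PiYdd C)) (h1LimKummerOn (phi C) (D.lDeltaTheta l) (PiYdd C) c hA hfi O)
        iota).H →*
      Multiplicative (h1Lim φ₀ (D.lDeltaTheta l) (⊤ : Subgroup P₀) ⊥)))
    (hR : ∀ t y, Multiplicative.toAdd (R t y) =
      h1LimCongr (D.lDeltaTheta l) ⊤ (hφ t) ⊥
        (h1LimComap (phi C) (D.lDeltaTheta l) ((MonoidHom.id (Pi C)).comp (s t)) (hι t) (hN t)
          (AddEquiv.additiveMultiplicative (h1Lim (phi C) (D.lDeltaTheta l) (PiYdd C) ⊥) (Additive.ofMul y))))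
    {S' : Submonoid (Lbl → Multiplicative (h1Lim φ₀ (D.lDeltaTheta l) (⊤ : Subgroup P₀) ⊥))}
    (e : splitMonoid ((thetaEnvData C hC hS hl hp2 hpl hζ mods f hf hmods h15 L hZ hcharY hlim).toRecord
        (h1LimConjMulAut (phi C) (D.lDeltaTheta l) (PiYdd C)) (h1LimKummerOn (phi C) (D.lDeltaTheta l) (PiYdd C) c hA hfi O)
        iota).units
      (Submonoid.powers θ) ≃* S')
    (he : ∀ x, ((e x : S') : Lbl → _) = MonoidHom.pi (fun t => (R t).comp (splitMonoid
      ((thetaEnvData C hC hS hl hp2 hpl hζ mods f hf hmods h15 L hZ hcharY hlim).toRecord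
        (h1LimConjMulAut (phi C) (D.lDeltaTheta l) (PiYdd C)) (h1LimKummerOn (phi C) (D.lDeltaTheta l) (PiYdd C) c hA hfi O)
        iota).units
      (Submonoid.powers θ)).subtype) x)
    (t₀ : Lbl) (g : P₀)
    (x : splitMonoid ((thetaEnvData C hC hS hl hp2 hpl hζ mods f hf hmods h15 L hZ hcharY hlim).toRecord
        (h1LimConjMulAut (phi C) (D.lDeltaTheta l) (PiYdd C)) (h1LimKummerOn (phi C) (D.lDeltaTheta l) (PiYdd C) c hA hfi O)
        iota).units
      (Submonoid.powers θ))
    (hx : ((thetaEnvData C hC hS hl hp2 hpl hζ mods f hf hmods h15 L hZ hcharY hlim).toRecord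
        (h1LimConjMulAut (phi C) (D.lDeltaTheta l) (PiYdd C)) (h1LimKummerOn (phi C) (D.lDeltaTheta l) (PiYdd C) c hA hfi O)
        iota).conj (s t₀ g)
      (x : ((thetaEnvData C hC hS hl hp2 hpl hζ mods f hf hmods h15 L hZ hcharY hlim).toRecord
        (h1LimConjMulAut (phi C) (D.lDeltaTheta l) (PiYdd C)) (h1LimKummerOn (phi C) (D.lDeltaTheta l) (PiYdd C) c hA hfi O)
        iota).H) ∈
      splitMonoid ((thetaEnvData C hC hS hl hp2 hpl hζ mods f hf hmods h15 L hZ hcharY hlim).toRecord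
        (h1LimConjMulAut (phi C) (D.lDeltaTheta l) (PiYdd C)) (h1LimKummerOn (phi C) (D.lDeltaTheta l) (PiYdd C) c hA hfi O)
        iota).units
        (Submonoid.powers θ)) :
    ((e ⟨_, hx⟩ : S') : Lbl → _) = piIso Lbl (h1LimConjMulAut φ₀ (D.lDeltaTheta l) ⊤ g) (e x : Lbl → _) :=
  restrictionIso'_equivariant_ofKummerHom_labelwise
    ((thetaEnvData C hC hS hl hp2 hpl hζ mods f hf hmods h15 L hZ hcharY hlim).toRecord
        (h1LimConjMulAut (phi C) (D.lDeltaTheta l) (PiYdd C)) (h1LimKummerOn (phi C) (D.lDeltaTheta l) (PiYdd C) c hA hfi O)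
        iota)
    (MulDistribMulAction.toMulAut (Pi C) A) O (fun σ b hb => hO σ b hb)
    (h1LimKummerOn (phi C) (D.lDeltaTheta l) (PiYdd C) c hA hfi O) (phi C) φ₀ (D.lDeltaTheta l) (PiYdd C)
    (MonoidHom.id (Pi C)) (AddEquiv.additiveMultiplicative (h1Lim (phi C) (D.lDeltaTheta l) (PiYdd C) ⊥)) s hι hN hφ
    (ThetaEnvData.toRecord_constantMonoid _ _ _ _)
    (fun (σ : Pi C) m => h1LimKummerOn_smul (phi C) (D.lDeltaTheta l) (PiYdd C) c hA hfi O σ m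
      ⟨σ • (m : A), hO σ m m.2⟩ rfl)
    q (fun x hx a ha => hq x hx a ha) w hsec
    (fun _ _ => rfl) θ
    (toRecord_topClass (thetaEnvData C hC hS hl hp2 hpl hζ mods f hf hmods h15 L hZ hcharY hlim)
      (CohomologySystemOfContH1.h1LimConjMulAut (phi C) (D.lDeltaTheta l) (PiYdd C))
      (h1LimKummerOn (phi C) (D.lDeltaTheta l) (PiYdd C) c hA hfi O)
      iota
      (phi C) (D.lDeltaTheta l) (PiYdd C)
      (AddEquiv.additiveMultiplicative (h1Lim (phi C) (D.lDeltaTheta l) (PiYdd C) ⊥)) (fun y _ => ⟨y, rfl⟩) hθ)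
    R hR e he t₀ g x hx

include hO in
/-- **IUTchII:Cor3.5(ii)** (kurims p.95) at `∞Ψ^ι_env(𝕄_*)`, FAITHFUL (torsion) form, **AT THE GENUINE `θ_env` DATA, ANY inversion family `iota`**: for every
`θ ∈ θ^ι_env(𝕄_*)` and `x ∈ ∞Ψ^{i}_env = M^×_TM · ⟨∞θ^{i}_env⟩`, the product restriction of `s_{t₀}(g)·x` is the diagonal
translate of the product restriction of `x` up to a family of `n`-torsion classes (`n > 0`, `x^n ∈ M^×_TM · θ^ℕ`), given
print's root condition `hroots` on the generators `∞θ^{i}_env` (Prop 1.4 p. 27); inputs = evaluation-sections data + model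
data + `hroots`. [cite: Mochizuki2012, Cor 3.5 (ii) p.95] -/
theorem pi_restriction_inftyThetaMonoid_upToTorsion_toRecord_of_mem_thetaEnv
    {K : Type*} [Group K] (q : Pi C →* K) (hq : ∀ x : Pi C, q x = 1 → ∀ a ∈ O, x • a = a) (w : P₀ →* K)
    (hsec : ∀ t g, q (s t g) = w g) {i₀ : Iota}
    {θ : ((thetaEnvData C hC hS hl hp2 hpl hζ mods f hf hmods h15 L hZ hcharY hlim).toRecord
        (h1LimConjMulAut (phi C) (D.lDeltaTheta l) (PiYdd C)) (h1LimKummerOn (phi C) (D.lDeltaTheta l) (PiYdd C) c hA hfi O)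
        iota).H}
    (hθ : θ ∈ ((thetaEnvData C hC hS hl hp2 hpl hζ mods f hf hmods h15 L hZ hcharY hlim).toRecord
        (h1LimConjMulAut (phi C) (D.lDeltaTheta l) (PiYdd C)) (h1LimKummerOn (phi C) (D.lDeltaTheta l) (PiYdd C) c hA hfi O)
        iota).thetaEnv i₀)
    (i : ((thetaEnvData C hC hS hl hp2 hpl hζ mods f hf hmods h15 L hZ hcharY hlim).toRecord
        (h1LimConjMulAut (phi C) (D.lDeltaTheta l) (PiYdd C)) (h1LimKummerOn (phi C) (D.lDeltaTheta l) (PiYdd C) c hA hfi O)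
        iota).Iota)
    (hroots : ∀ ϑ ∈ ((thetaEnvData C hC hS hl hp2 hpl hζ mods f hf hmods h15 L hZ hcharY hlim).toRecord
        (h1LimConjMulAut (phi C) (D.lDeltaTheta l) (PiYdd C)) (h1LimKummerOn (phi C) (D.lDeltaTheta l) (PiYdd C) c hA hfi O)
        iota).inftyThetaEnv i,
      ∃ n : ℕ, 0 < n ∧ ϑ ^ n ∈
        splitMonoid ((thetaEnvData C hC hS hl hp2 hpl hζ mods f hf hmods h15 L hZ hcharY hlim).toRecord
        (h1LimConjMulAut (phi C) (D.lDeltaTheta l) (PiYdd C)) (h1LimKummerOn (phi C) (D.lDeltaTheta l) (PiYdd C) c hA hfi O)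
        iota).units
          (Submonoid.powers θ))
    (R : Lbl → (((thetaEnvData C hC hS hl hp2 hpl hζ mods f hf hmods h15 L hZ hcharY hlim).toRecord
        (h1LimConjMulAut (phi C) (D.lDeltaTheta l) (PiYdd C)) (h1LimKummerOn (phi C) (D.lDeltaTheta l) (PiYdd C) c hA hfi O)
        iota).H →*
      Multiplicative (h1Lim φ₀ (D.lDeltaTheta l) (⊤ : Subgroup P₀) ⊥)))
    (hR : ∀ t y, Multiplicative.toAdd (R t y) =
      h1LimCongr (D.lDeltaTheta l) ⊤ (hφ t) ⊥
        (h1LimComap (phi C) (D.lDeltaTheta l) ((MonoidHom.id (Pi C)).comp (s t)) (hι t) (hN t)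
          (AddEquiv.additiveMultiplicative (h1Lim (phi C) (D.lDeltaTheta l) (PiYdd C) ⊥) (Additive.ofMul y))))
    {x : ((thetaEnvData C hC hS hl hp2 hpl hζ mods f hf hmods h15 L hZ hcharY hlim).toRecord
        (h1LimConjMulAut (phi C) (D.lDeltaTheta l) (PiYdd C)) (h1LimKummerOn (phi C) (D.lDeltaTheta l) (PiYdd C) c hA hfi O)
        iota).H}
    (hx : x ∈ ((thetaEnvData C hC hS hl hp2 hpl hζ mods f hf hmods h15 L hZ hcharY hlim).toRecord
        (h1LimConjMulAut (phi C) (D.lDeltaTheta l) (PiYdd C)) (h1LimKummerOn (phi C) (D.lDeltaTheta l) (PiYdd C) c hA hfi O)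
        iota).inftyThetaMonoid i)
    (t₀ : Lbl) (g : P₀) :
    ∃ (n : ℕ) (u : Lbl → ((thetaEnvData C hC hS hl hp2 hpl hζ mods f hf hmods h15 L hZ hcharY hlim).toRecord
        (h1LimConjMulAut (phi C) (D.lDeltaTheta l) (PiYdd C)) (h1LimKummerOn (phi C) (D.lDeltaTheta l) (PiYdd C) c hA hfi O)
        iota).H),
      0 < n ∧ (∀ t, u t ^ n = 1) ∧
      MonoidHom.pi R
          (((thetaEnvData C hC hS hl hp2 hpl hζ mods f hf hmods h15 L hZ hcharY hlim).toRecord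
        (h1LimConjMulAut (phi C) (D.lDeltaTheta l) (PiYdd C)) (h1LimKummerOn (phi C) (D.lDeltaTheta l) (PiYdd C) c hA hfi O)
        iota).conj (s t₀ g) x) =
        (fun t => R t (u t)) * piIso Lbl (h1LimConjMulAut φ₀ (D.lDeltaTheta l) ⊤ g) (MonoidHom.pi R x) :=
  pi_restriction_inftyThetaMonoid_upToTorsion_ofKummerHom_labelwise
    ((thetaEnvData C hC hS hl hp2 hpl hζ mods f hf hmods h15 L hZ hcharY hlim).toRecord
        (h1LimConjMulAut (phi C) (D.lDeltaTheta l) (PiYdd C)) (h1LimKummerOn (phi C) (D.lDeltaTheta l) (PiYdd C) c hA hfi O)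
        iota)
    (MulDistribMulAction.toMulAut (Pi C) A) O (fun σ b hb => hO σ b hb)
    (h1LimKummerOn (phi C) (D.lDeltaTheta l) (PiYdd C) c hA hfi O) (phi C) φ₀ (D.lDeltaTheta l) (PiYdd C)
    (MonoidHom.id (Pi C)) (AddEquiv.additiveMultiplicative (h1Lim (phi C) (D.lDeltaTheta l) (PiYdd C) ⊥)) s hι hN hφ
    (ThetaEnvData.toRecord_constantMonoid _ _ _ _)
    (fun (σ : Pi C) m => h1LimKummerOn_smul (phi C) (D.lDeltaTheta l) (PiYdd C) c hA hfi O σ m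
      ⟨σ • (m : A), hO σ m m.2⟩ rfl)
    q (fun x hx a ha => hq x hx a ha) w hsec
    (fun _ _ => rfl) i θ
    (toRecord_topClass (thetaEnvData C hC hS hl hp2 hpl hζ mods f hf hmods h15 L hZ hcharY hlim)
      (CohomologySystemOfContH1.h1LimConjMulAut (phi C) (D.lDeltaTheta l) (PiYdd C))
      (h1LimKummerOn (phi C) (D.lDeltaTheta l) (PiYdd C) c hA hfi O)
      iota
      (phi C) (D.lDeltaTheta l) (PiYdd C)
      (AddEquiv.additiveMultiplicative (h1Lim (phi C) (D.lDeltaTheta l) (PiYdd C) ⊥)) (fun y _ => ⟨y, rfl⟩) hθ)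
    hroots R hR hx t₀ g

end EtaleLevels

end Literature.IUT.HodgeArakelov

end
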